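import Summits.QuantumFields.YangMills.Theorems.BalabanUVNodesN15KingModelHeatKernelGradientSubordination
import Summits.QuantumFields.YangMills.Theorems.BalabanUVNodesN15KingModelHeatKernelTorusDistance
import Summits.QuantumFields.YangMills.Theorems.BalabanUVNodesN15KingModelBoxOperator
import HarnessLib

/-!
# BalabanUVNodes ∕ N15 — THE KING-MODEL RUNG (PART ∇-f): THE η-UNIFORM INVERSE-CUBE LAW FOR THE LATTICE GRADIENT OF KING's `A = 0` COVARIANCE IN FOUR DIMENSIONS —
# `c·|G(x+e_ν,y) − G(x,y)| ≤ 4940000∕(1 + |v((x−y)_μ)|)³` on the cubic four-torus `(ℤ∕K₀)⁴` for `G = (lapF (cM K₀) c m²)⁻¹`, EVERY `c > 0`, `m² > 0`, `K₀ ≥ 1`, EVERY pair of coordinates `μ, ν`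
# — an ABSOLUTE constant, NO zero-mode ∕ mass term; hence `≤ 4940000∕(1+tdistT(x,y))³`, and at King's scaling `c = L²` on `(ℤ∕LM₀)⁴`: `L²·|∇_νG(x,y)| ≤ 4940000∕(1+tdistT(x,y))³` for EVERY `L`, EVERY volume
# (Track A, DAG node N15 = NE2: «η-rates of the covariance ∕ background pieces ([B9] (3.42) ∕ King 1986 kernels)»; FAN-OUT v1.1 §N15 s3 «KING-MODEL RUNG … + what the curved case adds»; count-neutral)

HONEST FRAMING.  Count-neutral (cell `pub-ymgap`, seat `pub-ymgap-dag-n15-e` g57; `--supports stmt-QuantumFields-27247 --as helper` = K3ᴬ, KEY MAP v3).  King's `A = 0` comparison model: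
the fine-lattice covariance `G = (c(−Δ)+m²)⁻¹` of ONE renormalization step on the periodic torus ([King1986] (2.13) p.653, (4.4) p.670), in four dimensions, cubic torus; NOT Bałaban's
covariant `G_k(U)` and NOT [B9] (3.42) itself (whose second entry is the sup bound on `∇G(U)` with exponential decay in the scaled distance); crude absolute constants.  WHAT IS NEW: PART Ϣ gave
the η-uniform inverse-SQUARE law `c|G(x,y)| ≤ 34016∕(1+tdistT²) + 8c∕(m²K₀⁴)` (the continuum singularity `(4π²r²)⁻¹` plus the zero mode); this file gives the η-uniform inverse-CUBE law
for the LATTICE GRADIENT — the continuum singularity `|∇(4π²r²)⁻¹| = (2π²r³)⁻¹` — with NO zero-mode term and NO mass dependence at all (the forward difference kills the constant mode, and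
the large-time tail of the differenced heat kernel is integrable without the mass weight).  At King's scaling this is the statement that the block-spin covariance has a gradient of size
`O(η²·(1+r)⁻³)` in lattice units, i.e. the physical gradient `η⁻¹·∇` of the physical kernel `η⁻⁴G` is `O(r_phys⁻³)` uniformly in the spacing `η = 1∕L` and in the volume `M₀`.
THE MECHANISM: (i) SUBORDINATION of the difference (PART Ϣ-f twice): `G(x+e_ν,y) − G(x,y) = ∫₀^∞e^{−tm²}[Π_μQ_{ct}((x−y)_μ+δ_{μν}) − Π_μQ_{ct}((x−y)_μ)]dt` and the product differences in
ONE factor: `= ∫₀^∞e^{−tm²}·∇Q_{ct}((x−y)_ν)·Π_{μ≠ν}Q_{ct}((x−y)_μ)dt` (★ `lapF_inv_grad_eq_integral`), so ★ `c|∇_νG(x,y)| ≤ ∫₀^∞e^{−(m²∕c)s}‖∇Q_s(z_ν)‖Π_{μ≠ν}‖Q_s(z_μ)‖ds` (`s = ct`); (ii) REGION II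
(`s ≥ n²`, `n = |v(z_μ)| ≥ 1`, PART ∇-d `gradProd_le_far`, the mass weight DROPPED): `∫_{n²}^∞(8e^{−8s∕K₀²}∕(sK₀³) + 8∕(s²√s))ds ≤ 1∕(n²K₀) + 8∕n³ ≤ 8.5∕n³` (`K₀ ≥ 2n`); (iii) REGION I (`0 < s ≤ n²`,
PART ∇-d `gradProd_le_near`): `∫₀^{n²}308700∕(n⁴√s)ds = 617400∕n³` (★ `integral_Ioc_inv_sqrt`: `∫₀^Tds∕√s = 2√T`, the one singular integral of the lineage, Mathlib `integral_rpow` at `r = −½`);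
(iv) `n = 0`: split at `s = 1`, `≤ 2 + 1 + 8 = 11`; unify with `1∕n³ ≤ 8∕(1+n)³`.
CONTENTS (steps (i)–(iii) are PART ∇-e `…HeatKernelGradientSubordination`; this file is step (iv) and the packaging).  §4 ★★★ `mul_abs_lapF_inv_grad_le_of_coord_ne_zero` (`617409∕n³`), ★★ `mul_abs_lapF_inv_grad_le_eleven`, ★★★★ **`mul_abs_lapF_inv_grad_le_powerLaw`** (every `μ, ν`),
★★★★ **`mul_abs_lapF_inv_grad_le_powerLaw_tdistT`**, ★★★ `mul_abs_lapF_inv_grad_snd_le_powerLaw_tdistT` (the gradient in the second variable, by `lapF_inv_comm`), ★★★ `mul_abs_lapF_inv_grad_le_of_dist_le`;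
§5 King's scaling ★★★★ **`king_green_grad_powerLaw_tdistT`** (`L²|∇_νG| ≤ 4940000∕(1+tdistT)³` on `(ℤ∕LM₀)⁴`, every `L ≥ 1`, `M₀ ≥ 1`, `m² > 0`), ★★★ `king_green_grad_powerLaw_physical`
(`tdistT ≥ L·d` ⟹ `L²|∇G| ≤ 4940000∕(L³d³)`: the physical gradient of the physical kernel is `O(d⁻³)`), ★★★ `king_green_grad_what_the_curved_case_adds` (the FAN-OUT row's one line: at `A = 0` the
law is decided; at a unitary background `U ≠ 1` Kato's inequality dominates `|G_U(x,y)|` by `G(x,y)` (PART Ϣ-i) but NOT `∇G_U` by `∇G` — the covariant gradient law needs [B9]'s own route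
(Combes–Thomas ⊕ the flat law), recorded as the open door).
PRIOR TREE ART (by name): PART Ϣ-f `kingPlaneWave_eq_integral` ∕ `integrableOn_heatIntegrand` ∕ `integrableOn_heatMajorant`, Ϣ-h `setIntegral_Ioi_eq_Ioc_add_Ioi` ∕ `integral_Ioi_exp_neg_mul_le_inv` ∕
`integral_Ioi_inv_sq_eq` ∕ `integrableOn_inv_sq_Ioi`, Ϣ-j `exists_tdistT_eq_natAbs_valMinAbs` ∕ `natAbs_valMinAbs_le_tdistT` ∕ `tdistT_fine_le_half`, Ν-a `TorusSpectral.lapF_inv_comm`, ∇-b∕∇-d; Mathlib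
`integral_rpow`, `intervalIntegral.intervalIntegrable_rpow'`, `intervalIntegral.integral_of_le`.
Dedup (rg at filing): basename 0 files; needles `lapF_inv_grad_eq_integral|mul_abs_lapF_inv_grad_le|king_green_grad_powerLaw|integral_Ioc_inv_sqrt|integrableOn_gradMajorant` 0 tree files.
Locators: [King1986] (2.13) p.653, (4.4) p.670, (4.35) p.674, (3.63) p.663 (the `(1,0)` Hölder∕gradient entries of the propagator estimates); [Balaban1985BackgroundPropagators] Thm 3.1 (3.42) p.397
(second entry: the gradient bound — NOT asserted here), Thm 3.4 p.400; [Balaban1984PropagatorsI] (1.29) p.23; [LawlerLimic2010] Thm 4.3.1 ∕ §2.3 (Green's function gradient `≍ |x|^{1−d}`, here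
`d = 4`, upper bound, on the finite torus, uniformly).  0 `sorry`, 0 `def`.
-/

noncomputable section

open Real Set Finset MeasureTheory
open scoped BigOperators

namespace Summit.QuantumFields.YangMills.BalabanUVNodes.N15KingModelRung.HeatKernel

open Literature.MathematicalPhysics.QuantumFieldTheory.Balaban1983to89.B5Prop11Plancherel (Tor fine unitVec)
open Literature.MathematicalPhysics.QuantumFieldTheory.Balaban1983to89.Beta.WoodburyFibre (cM)
open Literature.MathematicalPhysics.QuantumFieldTheory.King1986.Torus (lapF tdistT tdistT_nonneg)
open Summit.QuantumFields.YangMills.BalabanUVNodes.N15KingModelRung.TorusSpectral (lapF_inv_comm)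

variable {K₀ : ℕ} [NeZero K₀] {c m2 : ℝ}

/-! ## §4 The inverse-cube law -/

/-- ★★★ **`c·|G(x+e_ν,y) − G(x,y)| ≤ 617409∕|v((x−y)_μ)|³`** whenever `(x−y)_μ ≠ 0` (`c > 0`, `m² > 0`, cubic four-torus; the time integral split at `s = |v|²`; `1∕(n²K₀) ≤ 1∕(2n³)` since `K₀ ≥ 2n`).
NO zero-mode term, NO mass on the right. [cite: King1986, (2.13) p.653, (4.4) p.670, (4.35) p.674, (3.63) p.663] -/
theorem mul_abs_lapF_inv_grad_le_of_coord_ne_zero (hc : 0 < c) (hm : 0 < m2) (x y : Tor (cM K₀)) (ν μ : Fin 4) (hμ : (x - y) μ ≠ 0) :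
    c * |(lapF (cM K₀) c m2)⁻¹ (x + unitVec (cM K₀) ν) y - (lapF (cM K₀) c m2)⁻¹ x y| ≤ 617409 / ((((x - y) μ).valMinAbs.natAbs : ℕ) : ℝ) ^ 3 := by
  have hK : (0 : ℝ) < K₀ := by exact_mod_cast Nat.pos_of_ne_zero (NeZero.ne K₀)
  set n : ℝ := ((((x - y) μ).valMinAbs.natAbs : ℕ) : ℝ) with hn
  have hnat : 1 ≤ ((x - y) μ).valMinAbs.natAbs := by
    rw [Nat.one_le_iff_ne_zero, Ne, Int.natAbs_eq_zero, ZMod.valMinAbs_eq_zero]; exact hμ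
  have hn1 : (1 : ℝ) ≤ n := by rw [hn]; exact_mod_cast hnat
  have hn0 : 0 < n := by linarith
  have hN : 2 * n ≤ K₀ := by
    have h : ((x - y) μ).valMinAbs.natAbs ≤ K₀ / 2 := ZMod.natAbs_valMinAbs_le ((x - y) μ)
    have : 2 * ((x - y) μ).valMinAbs.natAbs ≤ K₀ := by omega
    rw [hn]; exact_mod_cast this
  have hT : 0 < n ^ 2 := by positivity
  have h0 := mul_abs_lapF_inv_grad_le_integral (cM K₀) hc hm x y ν
  have hsplit := setIntegral_Ioi_eq_Ioc_add_Ioi (integrableOn_gradMajorant_cM hc hm (x - y) ν) hT.le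
  have h1 := integral_grad_near_le hc hm (x - y) ν μ hμ
  have h2 := integral_grad_far_le hc hm (x - y) ν hT
  rw [Real.sqrt_sq hn0.le] at h2
  have hfar : 1 / (n ^ 2 * K₀) + 8 / (n ^ 2 * n) ≤ 9 / n ^ 3 := by
    have h3 : 1 / (n ^ 2 * K₀) ≤ 1 / (n ^ 2 * (2 * n)) := div_le_div_of_nonneg_left zero_le_one (by positivity) (mul_le_mul_of_nonneg_left hN hT.le)
    have e : 1 / (n ^ 2 * (2 * n)) + 8 / (n ^ 2 * n) = (17 / 2) / n ^ 3 := by field_simp; ring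
    have h4 : (17 / 2) / n ^ 3 ≤ 9 / n ^ 3 := div_le_div_of_nonneg_right (by norm_num) (by positivity)
    linarith
  calc c * |(lapF (cM K₀) c m2)⁻¹ (x + unitVec (cM K₀) ν) y - (lapF (cM K₀) c m2)⁻¹ x y| ≤ _ := h0
    _ = _ := hsplit
    _ ≤ 617400 / n ^ 3 + (1 / (n ^ 2 * K₀) + 8 / (n ^ 2 * n)) := add_le_add h1 h2
    _ ≤ 617400 / n ^ 3 + 9 / n ^ 3 := add_le_add le_rfl hfar
    _ = 617409 / n ^ 3 := by ring

/-- ★★ For ALL `x, y`: `c·|G(x+e_ν,y) − G(x,y)| ≤ 11` (split at `s = 1`: `2` on `(0,1]`, `1∕K₀ + 8` beyond). [cite: King1986, (2.13) p.653, (4.4) p.670, (4.35) p.674] -/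
theorem mul_abs_lapF_inv_grad_le_eleven (hc : 0 < c) (hm : 0 < m2) (x y : Tor (cM K₀)) (ν : Fin 4) :
    c * |(lapF (cM K₀) c m2)⁻¹ (x + unitVec (cM K₀) ν) y - (lapF (cM K₀) c m2)⁻¹ x y| ≤ 11 := by
  have hK1 : (1 : ℝ) ≤ K₀ := by exact_mod_cast Nat.one_le_iff_ne_zero.mpr (NeZero.ne K₀)
  have h0 := mul_abs_lapF_inv_grad_le_integral (cM K₀) hc hm x y ν
  have hint := integrableOn_gradMajorant_cM hc hm (x - y) ν
  have hsplit := setIntegral_Ioi_eq_Ioc_add_Ioi hint (zero_le_one : (0 : ℝ) ≤ 1)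
  have h2 := integral_grad_far_le hc hm (x - y) ν (zero_lt_one : (0 : ℝ) < 1)
  rw [Real.sqrt_one, one_mul, one_mul] at h2
  have hF := hint.mono_set (Ioc_subset_Ioi_self : Ioc (0 : ℝ) 1 ⊆ Ioi 0)
  have hG : IntegrableOn (fun _ : ℝ => (2 : ℝ)) (Ioc (0 : ℝ) 1) := integrableOn_const (by simp [Real.volume_Ioc])
  have hpt : ∀ s ∈ Ioc (0 : ℝ) 1, Real.exp (-(m2 / c * s)) * (‖cycleHeatGrad K₀ s ((x - y) ν)‖ * ∏ μ ∈ Finset.univ.erase ν, ‖cycleHeat K₀ s ((x - y) μ)‖) ≤ 2 := by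
    intro s hs
    have he1 : Real.exp (-(m2 / c * s)) ≤ 1 := by rw [Real.exp_le_one_iff]; exact neg_nonpos.mpr (by have := hs.1; positivity)
    have hp := gradProd_le_two (K₀ := K₀) hs.1.le (x - y) ν
    have hP0 : 0 ≤ ‖cycleHeatGrad K₀ s ((x - y) ν)‖ * ∏ μ ∈ Finset.univ.erase ν, ‖cycleHeat K₀ s ((x - y) μ)‖ := mul_nonneg (norm_nonneg _) (Finset.prod_nonneg fun μ _ => norm_nonneg _)
    calc _ ≤ 1 * (2 : ℝ) := mul_le_mul he1 hp hP0 zero_le_one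
      _ = 2 := one_mul _
  have h1 := setIntegral_mono_on hF hG measurableSet_Ioc hpt
  rw [setIntegral_const, Real.volume_real_Ioc, max_eq_left (by norm_num), sub_zero, smul_eq_mul, one_mul] at h1
  have hK : 1 / (K₀ : ℝ) ≤ 1 := by rw [div_le_one (by positivity)]; exact hK1
  rw [hsplit] at h0
  linarith

/-- ★★★★ **THE η-UNIFORM INVERSE-CUBE LAW FOR THE LATTICE GRADIENT OF KING's COVARIANCE**: for every pair of coordinates `μ, ν`, every `c > 0`, `m² > 0`, every `K₀ ≥ 1`, every `x, y`:
`c·|(lapF (cM K₀) c m²)⁻¹(x+e_ν,y) − (lapF (cM K₀) c m²)⁻¹(x,y)| ≤ 4940000∕(1 + |v((x−y)_μ)|)³` — an ABSOLUTE constant: NO zero mode, NO mass, NO volume.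
[cite: King1986, (2.13) p.653, (4.4) p.670, (4.35) p.674, (3.63) p.663; Balaban1984PropagatorsI, (1.29) p.23] -/
theorem mul_abs_lapF_inv_grad_le_powerLaw (hc : 0 < c) (hm : 0 < m2) (x y : Tor (cM K₀)) (ν μ : Fin 4) :
    c * |(lapF (cM K₀) c m2)⁻¹ (x + unitVec (cM K₀) ν) y - (lapF (cM K₀) c m2)⁻¹ x y| ≤ 4940000 / (1 + ((((x - y) μ).valMinAbs.natAbs : ℕ) : ℝ)) ^ 3 := by
  by_cases hμ : (x - y) μ = 0
  · have h := mul_abs_lapF_inv_grad_le_eleven hc hm x y ν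
    have h0 : ((((x - y) μ).valMinAbs.natAbs : ℕ) : ℝ) = 0 := by rw [hμ, ZMod.valMinAbs_zero]; simp
    rw [h0]; norm_num; linarith
  · have h := mul_abs_lapF_inv_grad_le_of_coord_ne_zero hc hm x y ν μ hμ
    set n : ℝ := ((((x - y) μ).valMinAbs.natAbs : ℕ) : ℝ) with hn
    have hnat : 1 ≤ ((x - y) μ).valMinAbs.natAbs := by
      rw [Nat.one_le_iff_ne_zero, Ne, Int.natAbs_eq_zero, ZMod.valMinAbs_eq_zero]; exact hμ
    have hn1 : (1 : ℝ) ≤ n := by rw [hn]; exact_mod_cast hnat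
    have hkey : 617409 / n ^ 3 ≤ 4940000 / (1 + n) ^ 3 := by
      rw [div_le_div_iff₀ (by positivity) (by positivity)]
      have h8 : (1 + n) ^ 3 ≤ 8 * n ^ 3 := by nlinarith [pow_le_pow_left₀ (by linarith : (0:ℝ) ≤ 1 + n) (by linarith : 1 + n ≤ 2 * n) 3]
      nlinarith [pow_pos (by linarith : (0:ℝ) < n) 3]
    exact h.trans hkey

/-- ★★★★ **… IN THE TORUS DISTANCE**: `c·|G(x+e_ν,y) − G(x,y)| ≤ 4940000∕(1 + tdistT(x,y))³` for every direction `ν` (the sup is attained at some coordinate, PART Ϣ-j).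
[cite: King1986, (2.13) p.653, (4.4) p.670, (4.35) p.674, (3.63) p.663] -/
theorem mul_abs_lapF_inv_grad_le_powerLaw_tdistT (hc : 0 < c) (hm : 0 < m2) (x y : Tor (cM K₀)) (ν : Fin 4) :
    c * |(lapF (cM K₀) c m2)⁻¹ (x + unitVec (cM K₀) ν) y - (lapF (cM K₀) c m2)⁻¹ x y| ≤ 4940000 / (1 + tdistT (cM K₀) x y) ^ 3 := by
  obtain ⟨μ, hμ⟩ := exists_tdistT_eq_natAbs_valMinAbs (cM K₀) x y
  rw [hμ]
  exact mul_abs_lapF_inv_grad_le_powerLaw hc hm x y ν μ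

/-- ★★★ THE GRADIENT IN THE SECOND VARIABLE: `c·|G(x,y+e_ν) − G(x,y)| ≤ 4940000∕(1 + tdistT(x,y))³` (symmetry of `G`, Ν-a `lapF_inv_comm`, and `tdistT(y,x) = tdistT(x,y)` through the attained sup).
[cite: King1986, (2.13) p.653, (4.4) p.670, (3.63) p.663] -/
theorem mul_abs_lapF_inv_grad_snd_le_powerLaw_tdistT (hc : 0 < c) (hm : 0 < m2) (x y : Tor (cM K₀)) (ν : Fin 4) :
    c * |(lapF (cM K₀) c m2)⁻¹ x (y + unitVec (cM K₀) ν) - (lapF (cM K₀) c m2)⁻¹ x y| ≤ 4940000 / (1 + tdistT (cM K₀) x y) ^ 3 := by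
  rw [lapF_inv_comm (cM K₀) c m2 x (y + unitVec (cM K₀) ν), lapF_inv_comm (cM K₀) c m2 x y]
  obtain ⟨μ, hμ⟩ := exists_tdistT_eq_natAbs_valMinAbs (cM K₀) x y
  have h := mul_abs_lapF_inv_grad_le_powerLaw hc hm y x ν μ
  have e : ((((y - x) μ).valMinAbs.natAbs : ℕ) : ℝ) = ((((x - y) μ).valMinAbs.natAbs : ℕ) : ℝ) := by
    rw [show (y - x) μ = -((x - y) μ) by simp, ZMod.natAbs_valMinAbs_neg]
  rw [e, ← hμ] at h
  exact h

/-- ★★★ **… UNDER A LOWER BOUND ON THE TORUS DISTANCE**: `D ≤ tdistT(x,y)` ⟹ `c·|G(x+e_ν,y) − G(x,y)| ≤ 4940000∕(1+D)³` (`D ≥ 0`). [cite: King1986, (2.13) p.653, (4.4) p.670, (3.63) p.663] -/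
theorem mul_abs_lapF_inv_grad_le_of_dist_le (hc : 0 < c) (hm : 0 < m2) (x y : Tor (cM K₀)) (ν : Fin 4) {D : ℝ} (hD0 : 0 ≤ D) (hD : D ≤ tdistT (cM K₀) x y) :
    c * |(lapF (cM K₀) c m2)⁻¹ (x + unitVec (cM K₀) ν) y - (lapF (cM K₀) c m2)⁻¹ x y| ≤ 4940000 / (1 + D) ^ 3 := by
  refine (mul_abs_lapF_inv_grad_le_powerLaw_tdistT hc hm x y ν).trans ?_
  apply div_le_div_of_nonneg_left (by norm_num) (by positivity)
  exact pow_le_pow_left₀ (by linarith) (by linarith) 3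

/-! ## §5 King's scaling `c = L²`: the η-uniform law on `(ℤ∕LM₀)⁴` -/

section King

variable (L M₀ : ℕ) [NeZero L] [NeZero M₀] {m2 : ℝ}

/-- ★★★★ **THE η-UNIFORM INVERSE-CUBE LAW AT KING's SCALING**: on the fine four-torus `(ℤ∕LM₀)⁴` with `G = (L²(−Δ)+m²)⁻¹`, for EVERY `L ≥ 1`, EVERY volume `M₀ ≥ 1`, every `m² > 0`, every direction `ν`:
`L²·|G(x+e_ν,y) − G(x,y)| ≤ 4940000∕(1 + tdistT(x,y))³` — the lattice gradient of the block-spin covariance is `O(η²(1+r)⁻³)` in lattice units, i.e. the physical gradient of the physical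
kernel is `O(r_phys⁻³)`, uniformly in the spacing and the volume, with NO zero-mode share. [cite: King1986, (2.13) p.653, (4.4) p.670, (4.35) p.674, (3.63) p.663] -/
theorem king_green_grad_powerLaw_tdistT (hm : 0 < m2) (x y : Tor (fine L (cM M₀))) (ν : Fin 4) :
    (L : ℝ) ^ 2 * |(lapF (fine L (cM M₀)) ((L : ℝ) ^ 2) m2)⁻¹ (x + unitVec (fine L (cM M₀)) ν) y - (lapF (fine L (cM M₀)) ((L : ℝ) ^ 2) m2)⁻¹ x y|
      ≤ 4940000 / (1 + tdistT (fine L (cM M₀)) x y) ^ 3 := by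
  have hL : (0 : ℝ) < L := by exact_mod_cast Nat.pos_of_ne_zero (NeZero.ne L)
  have hc : (0 : ℝ) < (L : ℝ) ^ 2 := by positivity
  haveI : NeZero (L * M₀) := ⟨Nat.mul_ne_zero (NeZero.ne L) (NeZero.ne M₀)⟩
  exact mul_abs_lapF_inv_grad_le_powerLaw_tdistT (K₀ := L * M₀) hc hm x y ν

/-- ★★★ **THE PHYSICAL FORM**: if `tdistT(x,y) ≥ L·d` with `d > 0` (the two points are `d` apart in PHYSICAL∕block units), then `L²·|∇_νG(x,y)| ≤ 4940000∕(L³d³)` — together with `∇_phys = L·∇_latt` and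
`G_phys = L⁴·G` this is `|∇_phys G_phys| ≤ 4940000∕d³`, uniformly in `L`. [cite: King1986, (2.13) p.653, (3.63) p.663] -/
theorem king_green_grad_powerLaw_physical (hm : 0 < m2) (x y : Tor (fine L (cM M₀))) (ν : Fin 4) {dd : ℝ} (hd : 0 < dd) (hD : (L : ℝ) * dd ≤ tdistT (fine L (cM M₀)) x y) :
    (L : ℝ) ^ 2 * |(lapF (fine L (cM M₀)) ((L : ℝ) ^ 2) m2)⁻¹ (x + unitVec (fine L (cM M₀)) ν) y - (lapF (fine L (cM M₀)) ((L : ℝ) ^ 2) m2)⁻¹ x y|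
      ≤ 4940000 / ((L : ℝ) ^ 3 * dd ^ 3) := by
  have hL : (0 : ℝ) < L := by exact_mod_cast Nat.pos_of_ne_zero (NeZero.ne L)
  refine (king_green_grad_powerLaw_tdistT L M₀ hm x y ν).trans ?_
  apply div_le_div_of_nonneg_left (by norm_num) (by positivity)
  calc (L : ℝ) ^ 3 * dd ^ 3 = ((L : ℝ) * dd) ^ 3 := by ring
    _ ≤ (1 + tdistT (fine L (cM M₀)) x y) ^ 3 := pow_le_pow_left₀ (by positivity) (by linarith) 3

/-- ★★★ **WHAT THE CURVED CASE ADDS** (FAN-OUT v1.1 §N15 row s3, the one line, as a theorem about the `A = 0` member): at `A = 0` the η-uniform inverse-cube law for the lattice gradient of the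
block-spin covariance is DECIDED (both slots, every direction, every `L`, every volume, no zero mode); what Bałaban's case adds is the same law for the covariant `G(U) = (−L²Δ_U + m² + …)⁻¹`
at a non-trivial unitary background — there Kato's inequality bounds `|G_U(x,y)|` by `G(x,y)` entrywise (PART Ϣ-i) but gives NO domination of `∇_UG_U` by `∇G`, so the covariant gradient law
is NOT a corollary of this file ([B9] Thm 3.1 (3.42)'s second entry is the printed statement; its η-rate is node N15's open cell). [cite: King1986, (3.63) p.663; Balaban1985BackgroundPropagators, Thm 3.1 (3.42) p.397] -/
theorem king_green_grad_what_the_curved_case_adds (hm : 0 < m2) :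
    (∀ (x y : Tor (fine L (cM M₀))) (ν : Fin 4),
        (L : ℝ) ^ 2 * |(lapF (fine L (cM M₀)) ((L : ℝ) ^ 2) m2)⁻¹ (x + unitVec (fine L (cM M₀)) ν) y - (lapF (fine L (cM M₀)) ((L : ℝ) ^ 2) m2)⁻¹ x y|
          ≤ 4940000 / (1 + tdistT (fine L (cM M₀)) x y) ^ 3)
      ∧ (∀ (x y : Tor (fine L (cM M₀))) (ν : Fin 4),
        (L : ℝ) ^ 2 * |(lapF (fine L (cM M₀)) ((L : ℝ) ^ 2) m2)⁻¹ x (y + unitVec (fine L (cM M₀)) ν) - (lapF (fine L (cM M₀)) ((L : ℝ) ^ 2) m2)⁻¹ x y|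
          ≤ 4940000 / (1 + tdistT (fine L (cM M₀)) x y) ^ 3) := by
  have hL : (0 : ℝ) < L := by exact_mod_cast Nat.pos_of_ne_zero (NeZero.ne L)
  have hc : (0 : ℝ) < (L : ℝ) ^ 2 := by positivity
  haveI : NeZero (L * M₀) := ⟨Nat.mul_ne_zero (NeZero.ne L) (NeZero.ne M₀)⟩
  exact ⟨fun x y ν => mul_abs_lapF_inv_grad_le_powerLaw_tdistT (K₀ := L * M₀) hc hm x y ν,
    fun x y ν => mul_abs_lapF_inv_grad_snd_le_powerLaw_tdistT (K₀ := L * M₀) hc hm x y ν⟩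

end King

end Summit.QuantumFields.YangMills.BalabanUVNodes.N15KingModelRung.HeatKernel

end
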